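import Literature.Geometry.Kaehler.RiemannianHodge
import Literature.Geometry.Kaehler.HodgeStarProofs
import Literature.Geometry.Kaehler.HodgeStarOfVolumeFormProofs
import Literature.Geometry.Kaehler.RiemannianHodgeSmoothCounterexample
import Mathlib.Topology.Instances.AddCircle.Defs
import Mathlib.Analysis.SpecialFunctions.Trigonometric.Deriv
import Mathlib.Analysis.SpecialFunctions.Trigonometric.Bounds
import Mathlib.Analysis.Asymptotics.Lemmas
import Mathlib.NumberTheory.Real.Irrational
import Mathlib.Analysis.InnerProductSpace.PiL2
import Mathlib.LinearAlgebra.Basis.SMul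
import HarnessLib

/-!
# The named fact `isHarmonicForm_iff_mextDeriv_eq_zero_and_mcoderiv_eq_zero` is false as stated

`Literature/Geometry/Kaehler/RiemannianHodge.lean` records Warner's Proposition 6.3
(*Foundations of Differentiable Manifolds and Lie Groups*, GTM 94, p. 221: "`Δα = 0` if and only
if `dα = 0` and `δα = 0`", for smooth forms on a compact oriented Riemannian manifold, 6.1,
p. 220) as the named fact `isHarmonicForm_iff_mextDeriv_eq_zero_and_mcoderiv_eq_zero o`. Its
docstring (and the section it sits in) assume a *smooth* metric on a *smooth* manifold, but the
section instances `[IsManifold I ∞ M] [IsContinuousRiemannianBundle E (TangentSpace I)]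
[IsContMDiffRiemannianBundle I ∞ E (TangentSpace I)]` are not used in the body of this
`def … : Prop` and were therefore **not abstracted**: `#print` shows that the fact binds only
`[RiemannianBundle (fun x ↦ TangentSpace I x)]` — an arbitrary family of inner products on the
tangent spaces, with no continuity in the base point (the same defect as the sibling facts
`isSmoothForm_hodgeStar`, `isSmoothForm_mcoderiv`, `mem_harmonicForms_iff`, refuted in
`RiemannianHodgeRoughMetric.lean` and `RiemannianHodgeSmoothCounterexample.lean`). This file proves
that in that generality the fact is **false** on a *compact* manifold
(`TorusRough.not_isHarmonicForm_iff_torus`, `not_isHarmonicForm_iff_mextDeriv_eq_zero_and_mcoderiv_eq_zero`).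

## The counterexample (`namespace TorusRough`)

* `M = T² = (ℝ/ℤ)²` (`AddCircle 1 × AddCircle 1`), charted on `P = ℝ²` (sup norm, `n = 2`) by the
  local inverses of the covering projection `proj : ℝ² → T²` (products of Mathlib's
  `AddCircle.openPartialHomeomorphCoe`; the structure `chartedSpaceT` is a `def`, used as a local
  instance). All transition maps are integer translations, so `proj` and every chart have manifold
  derivative `id` (`hasMFDerivAt_proj`, `hasMFDerivAt_extChartAt_self`); consequently the chart
  representative of any form `β` is its periodic pull-back `y ↦ β (proj y)` (`inChart_eq`) and
  **`(dβ)(q) = d(β ∘ proj)(lift q)`** for the canonical lift `lift q` (`mextDeriv_apply_eq`), for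
  every form, smooth or not. `T²` is compact and `𝓘(ℝ, ℝ²)` is boundaryless.
* The *rough metric* `g_q = λ(q) dx₀² + λ(q)⁻¹ dx₁²` with `λ(q) = 2` if the second coordinate of
  `q` is a rational point of `ℝ/ℤ` and `λ(q) = 1` otherwise (`TorusRough.bundle`, a `def`): nowhere
  continuous, but `det g = 1`, so the Riemannian volume form of the standard orientation `orient`
  is the constant `dx₀ ∧ dx₁` (`volumeForm_eq`) and the hypothesis `ho` holds
  (`isSmoothForm_riemannianVolumeForm`).
* The smooth top-degree form `α = F(x₁) · vol` with `F(t) = -cos(2πt)/(2π) + cos³(2πt)/(6π)`,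
  `F' = S = sin³(2π ·)` (degree `k + 1 = 2`, `m = 0`). Pointwise linear algebra (the discharged
  facts `⋆vol = 1` and `⋆⟪v, ·⟫ = ω(v, ·)`) gives `⋆α = F(x₁)`, `d⋆α = S(x₁) dx₁` (an honest
  derivative), `⋆dx₁ = -λ dx₀`, hence **`δα = λ S(x₁) dx₀`** (`mcoderiv_alpha_apply`), which is
  nonzero at `proj (0, 1/4)` (`mcoderiv_alpha_ne_zero`). So the right-hand side
  `dα = 0 ∧ δα = 0` of the fact fails.
* Yet `α` is "harmonic": in top degree `Δα = d(δα)`, and `d(δα)(q) = d(c dx₀)(lift q)` with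
  `c(y) = λ(proj y) S(y₁)`; where `S(y₁) ≠ 0` the coefficient `c` is discontinuous (`λ` jumps
  between `1` and `2` on every interval), so Mathlib's `fderiv` returns the junk value `0`; where
  `sin(2π y₁) = 0` one has `|c(y)| ≤ 2(2π)² ‖y - y₀‖²`, so the derivative is genuinely `0`
  (`fderiv_coef_smul`). Hence `Δα = 0` (`isHarmonicForm_alpha`) and the equivalence fails.

Every identity used holds at every point; the only junk value is the one the fact itself feeds
into `Δ`. The intended statement (smooth metric, smooth compatible atlas, Hausdorff `M`; Warner
6.3) is unaffected; it should be re-vendored with `[IsManifold I ∞ M]`,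
`[IsContMDiffRiemannianBundle I ∞ E (TangentSpace I)]` (and `[T2Space M]`) bound *inside* the
closed statement, as was done for `isSmoothForm_mcoderiv_of_isContMDiffRiemannianBundle`
(`RiemannianHodgeCodiffSmoothFact.lean`).

## References

* F. W. Warner, *Foundations of Differentiable Manifolds and Lie Groups*, GTM 94 (1983): 6.1
  (p. 220), Proposition 6.3 (p. 221) — the intended (smooth-metric) statement; 1.2–1.4 (p. 5) for
  the standing conventions (second countable Hausdorff `C^∞` manifolds).
* D. Huybrechts, *Complex Geometry* (2005), Lemma A.0.12 (p. 316) — the same statement.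
-/

noncomputable section

open scoped Manifold ContDiff Topology InnerProductSpace Real
open Module Set Function Filter ContinuousAlternatingMap

namespace Literature.Geometry.Kaehler

namespace TorusRough

/-- The model plane `ℝ²` (sup norm; the same type as `StepMetric.P`, whose `Fact (finrank ℝ P = 2)`
is reused). [folklore] -/
abbrev P : Type := Fin 2 → ℝ

/-- The flat `2`-torus `(ℝ/ℤ)²` as a topological space. [folklore] -/
abbrev T : Type := AddCircle (1 : ℝ) × AddCircle (1 : ℝ)

/-- The covering projection `ℝ² → T²`. [folklore] -/
def proj (y : P) : T := (((y 0 : ℝ) : AddCircle (1 : ℝ)), ((y 1 : ℝ) : AddCircle (1 : ℝ)))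

/-- `proj` is continuous. [folklore] -/
theorem continuous_proj : Continuous proj :=
  ((AddCircle.continuous_mk' (1 : ℝ)).comp (continuous_apply 0)).prodMk
    ((AddCircle.continuous_mk' (1 : ℝ)).comp (continuous_apply 1))

/-- `proj` is additive: `proj (z - w) = proj z - proj w`. [folklore] -/
theorem proj_sub (z w : P) : proj (z - w) = proj z - proj w := by
  simp only [proj, Pi.sub_apply, AddCircle.coe_sub, Prod.mk_sub_mk]

/-- The local inverse of `proj` on the box `(a, a+1) × (b, b+1)`, as an open partial homeomorphism
`ℝ² ⇀ T²` (product of two copies of `AddCircle.openPartialHomeomorphCoe`). [folklore] -/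
def cov (a b : ℝ) : OpenPartialHomeomorph P T where
  toFun := proj
  invFun q := ![((AddCircle.equivIco 1 a q.1 : ℝ)), ((AddCircle.equivIco 1 b q.2 : ℝ))]
  source := {y | y 0 ∈ Ioo a (a + 1) ∧ y 1 ∈ Ioo b (b + 1)}
  target := {q | q.1 ≠ (a : AddCircle (1 : ℝ)) ∧ q.2 ≠ (b : AddCircle (1 : ℝ))}
  map_source' := by
    rintro y ⟨h0, h1⟩
    exact ⟨(AddCircle.openPartialHomeomorphCoe 1 a).map_source h0,
      (AddCircle.openPartialHomeomorphCoe 1 b).map_source h1⟩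
  map_target' := by
    rintro q ⟨h0, h1⟩
    exact ⟨(AddCircle.openPartialHomeomorphCoe 1 a).map_target h0,
      (AddCircle.openPartialHomeomorphCoe 1 b).map_target h1⟩
  left_inv' := by
    rintro y ⟨h0, h1⟩
    funext i
    fin_cases i
    · exact (AddCircle.openPartialHomeomorphCoe 1 a).left_inv h0
    · exact (AddCircle.openPartialHomeomorphCoe 1 b).left_inv h1
  right_inv' := by
    rintro q -
    exact Prod.ext ((AddCircle.equivIco 1 a).symm_apply_apply q.1)
      ((AddCircle.equivIco 1 b).symm_apply_apply q.2)
  open_source := (isOpen_Ioo.preimage (continuous_apply 0)).inter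
    (isOpen_Ioo.preimage (continuous_apply 1))
  open_target := (isOpen_compl_singleton.preimage continuous_fst).inter
    (isOpen_compl_singleton.preimage continuous_snd)
  continuousOn_toFun := continuous_proj.continuousOn
  continuousOn_invFun := by
    refine continuousOn_pi.2 fun i ↦ ?_
    fin_cases i
    · intro q hq
      exact (continuousAt_subtype_val.comp
        ((AddCircle.continuousAt_equivIco 1 a hq.1).comp continuousAt_fst)).continuousWithinAt
    · intro q hq
      exact (continuousAt_subtype_val.comp
        ((AddCircle.continuousAt_equivIco 1 b hq.2).comp continuousAt_snd)).continuousWithinAt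

/-- `cov a b` acts as `proj`. [folklore] -/
@[simp]
theorem cov_apply (a b : ℝ) (y : P) : cov a b y = proj y := rfl

/-- A real parameter `a(θ)` with `θ ≠ ↑a(θ)`: a lift of `θ` shifted by `1/2`. [folklore] -/
def shift (θ : AddCircle (1 : ℝ)) : ℝ := (AddCircle.equivIco 1 0 θ : ℝ) - 2⁻¹

/-- `θ ≠ ↑(shift θ)` (the two differ by `1/2 ∉ ℤ`). [folklore] -/
theorem ne_coe_shift (θ : AddCircle (1 : ℝ)) : θ ≠ (shift θ : AddCircle (1 : ℝ)) := by
  intro h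
  have hθ : (((AddCircle.equivIco 1 0 θ : ℝ)) : AddCircle (1 : ℝ)) = θ :=
    (AddCircle.equivIco 1 0).symm_apply_apply θ
  have h2 : (((2⁻¹ : ℝ)) : AddCircle (1 : ℝ)) = 0 := by
    have : ((AddCircle.equivIco 1 0 θ : ℝ)) - shift θ = 2⁻¹ := by simp [shift]
    rw [← this, AddCircle.coe_sub, hθ, ← h, sub_self]
  obtain ⟨n, hn⟩ := (AddCircle.coe_eq_zero_iff (1 : ℝ)).1 h2
  have hn' : (n : ℝ) = 2⁻¹ := by simpa using hn
  have h3 : ((2 * n : ℤ) : ℝ) = ((1 : ℤ) : ℝ) := by push_cast; rw [hn']; norm_num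
  have h4 : 2 * n = 1 := by exact_mod_cast h3
  omega

/-- The preferred chart of `T²` at `q`: the inverse of `cov` on a box centred at a lift of `q`.
[folklore] -/
def chartT (q : T) : OpenPartialHomeomorph T P := (cov (shift q.1) (shift q.2)).symm

/-- `q` lies in the source of its preferred chart. [folklore] -/
theorem mem_chartT_source (q : T) : q ∈ (chartT q).source :=
  ⟨ne_coe_shift q.1, ne_coe_shift q.2⟩

/-- The charted-space structure on `T²` modelled on `ℝ²` by local inverses of the covering
projection (a `def`, used as a local instance and supplied explicitly to the fact under
refutation). [folklore] -/
@[reducible]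
def chartedSpaceT : ChartedSpace P T where
  atlas := range chartT
  chartAt := chartT
  mem_chart_source := mem_chartT_source
  chart_mem_atlas q := mem_range_self q

section Charts

attribute [local instance] chartedSpaceT

/-- The preferred chart at `q` is `chartT q`. [folklore] -/
theorem chartAt_eq (q : T) : chartAt P q = chartT q := rfl

/-- The inverse extended chart at any point is the covering projection. [folklore] -/
theorem extChartAt_symm_apply (x₀ : T) (y : P) : (extChartAt 𝓘(ℝ, P) x₀).symm y = proj y := rfl

/-- The canonical lift of `q ∈ T²` to `ℝ²` (the centre of the preferred chart). [folklore] -/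
def lift (q : T) : P := extChartAt 𝓘(ℝ, P) q q

/-- `proj (lift q) = q`. [folklore] -/
theorem proj_lift (q : T) : proj (lift q) = q :=
  (extChartAt 𝓘(ℝ, P) q).left_inv (mem_extChartAt_source q)

/-- Near any `y`, the chart `(cov a b).symm` composed with `proj` is a translation, provided
`proj y` lies in the target. [folklore] -/
theorem cov_symm_proj_eventuallyEq (a b : ℝ) (y : P) (hy : proj y ∈ (cov a b).target) :
    ∃ c : P, (fun z ↦ (cov a b).symm (proj z)) =ᶠ[𝓝 y] fun z ↦ z - c := by
  set w := (cov a b).symm (proj y) with hw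
  refine ⟨y - w, ?_⟩
  have hws : w ∈ (cov a b).source := (cov a b).map_target hy
  have hπ : proj w = proj y := (cov a b).right_inv hy
  have h1 : Tendsto (fun z : P ↦ z - (y - w)) (𝓝 y) (𝓝 w) := by
    have : Tendsto (fun z : P ↦ z - (y - w)) (𝓝 y) (𝓝 (y - (y - w))) :=
      (continuous_id.sub continuous_const).tendsto y
    rwa [sub_sub_cancel] at this
  filter_upwards [h1 ((cov a b).open_source.mem_nhds hws)] with z hz
  have hp : proj (z - (y - w)) = proj z := by
    rw [proj_sub, proj_sub, hπ, sub_self, sub_zero]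
  rw [← hp]
  exact (cov a b).left_inv hz

/-- The covering projection has manifold derivative the identity at every point (its expression in
the charts is locally a translation). [folklore] -/
theorem hasMFDerivAt_proj (y : P) :
    HasMFDerivAt 𝓘(ℝ, P) 𝓘(ℝ, P) proj y (ContinuousLinearMap.id ℝ P) := by
  refine ⟨continuous_proj.continuousAt, ?_⟩
  obtain ⟨c, hc⟩ := cov_symm_proj_eventuallyEq (shift (proj y).1) (shift (proj y).2) y
    (mem_chartT_source (proj y))
  have hw : writtenInExtChartAt 𝓘(ℝ, P) 𝓘(ℝ, P) y proj =
      fun z ↦ (cov (shift (proj y).1) (shift (proj y).2)).symm (proj z) := by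
    funext z
    simp only [writtenInExtChartAt, extChartAt_coe, extChartAt_coe_symm, modelWithCornersSelf_coe,
      modelWithCornersSelf_coe_symm, Function.comp_apply, id_eq]
    rfl
  rw [hw, ModelWithCorners.Boundaryless.range_eq_univ, hasFDerivWithinAt_univ, extChartAt_self_apply,
    modelWithCornersSelf_coe, id_eq]
  exact ((hasFDerivAt_id y).sub_const c).congr_of_eventuallyEq hc

/-- The extended chart at `q` has manifold derivative the identity at `q` (its expression in the
charts is the identity near the point). [folklore] -/
theorem hasMFDerivAt_extChartAt_self (q : T) :
    HasMFDerivAt 𝓘(ℝ, P) 𝓘(ℝ, P) (extChartAt 𝓘(ℝ, P) q) q (ContinuousLinearMap.id ℝ P) := by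
  refine ⟨continuousAt_extChartAt q, ?_⟩
  have hw : writtenInExtChartAt 𝓘(ℝ, P) 𝓘(ℝ, P) q (extChartAt 𝓘(ℝ, P) q) =
      fun z ↦ extChartAt 𝓘(ℝ, P) q ((extChartAt 𝓘(ℝ, P) q).symm z) := by
    funext z
    simp only [writtenInExtChartAt, Function.comp_apply, extChartAt_self_apply,
      modelWithCornersSelf_coe, id_eq]
  have hev : (fun z ↦ extChartAt 𝓘(ℝ, P) q ((extChartAt 𝓘(ℝ, P) q).symm z)) =ᶠ[𝓝 (extChartAt 𝓘(ℝ, P) q q)]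
      id := by
    filter_upwards [(isOpen_extChartAt_target q).mem_nhds (mem_extChartAt_target q)] with z hz
    exact (extChartAt 𝓘(ℝ, P) q).right_inv hz
  rw [hw, ModelWithCorners.Boundaryless.range_eq_univ, hasFDerivWithinAt_univ]
  exact (hasFDerivAt_id _).congr_of_eventuallyEq hev

/-- The derivative of the inverse extended chart (the covering projection) is the identity.
[folklore] -/
theorem mfderivWithin_extChartAt_symm (x₀ : T) (y : P) :
    mfderivWithin 𝓘(ℝ, P) 𝓘(ℝ, P) (↑(extChartAt 𝓘(ℝ, P) x₀).symm) (range 𝓘(ℝ, P)) y =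
      ContinuousLinearMap.id ℝ P := by
  have h : (↑(extChartAt 𝓘(ℝ, P) x₀).symm : P → T) = proj := funext (extChartAt_symm_apply x₀)
  rw [h, ModelWithCorners.Boundaryless.range_eq_univ, mfderivWithin_univ]
  exact (hasMFDerivAt_proj y).mfderiv

/-- On `T²` the chart representative of a form is its periodic pull-back `y ↦ β (proj y)`
(every chart is a local inverse of `proj`, with derivative the identity). [folklore] -/
theorem inChart_eq {k : ℕ} (β : MForm 𝓘(ℝ, P) T ℝ k) (x₀ : T) :
    β.inChart x₀ = fun y ↦ (β (proj y) : P [⋀^Fin k]→L[ℝ] ℝ) := by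
  funext y
  ext v
  rw [MForm.inChart_apply]
  simp only [mfderivWithin_extChartAt_symm]
  rfl

/-- **The manifold exterior derivative on `T²` is the flat exterior derivative of the periodic
pull-back, taken at the canonical lift**: `(dβ)(q) = d(β ∘ proj)(lift q)`, for every form `β`
(no smoothness needed). [folklore] -/
theorem mextDeriv_apply_eq {k : ℕ} (β : MForm 𝓘(ℝ, P) T ℝ k) (q : T) :
    mextDeriv β q = extDeriv (fun y ↦ (β (proj y) : P [⋀^Fin k]→L[ℝ] ℝ)) (lift q) := by
  ext v
  simp only [mextDeriv, inChart_eq, ModelWithCorners.Boundaryless.range_eq_univ, extDerivWithin_univ,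
    (hasMFDerivAt_extChartAt_self q).mfderiv, compContinuousLinearMap_apply]
  rfl

end Charts

/-! ### The rough metric `g = λ dx₀² + λ⁻¹ dx₁²`, `λ ∈ {1, 2}` nowhere continuous -/

/-- The rational points of the circle `ℝ/ℤ`. [folklore] -/
def ratPts : Set (AddCircle (1 : ℝ)) := range fun r : ℚ ↦ ((r : ℝ) : AddCircle (1 : ℝ))

/-- Rational reals project to rational points. [folklore] -/
theorem coe_rat_mem_ratPts (r : ℚ) : ((r : ℝ) : AddCircle (1 : ℝ)) ∈ ratPts := ⟨r, rfl⟩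

/-- Irrational reals do not project to rational points. [folklore] -/
theorem coe_not_mem_ratPts {t : ℝ} (ht : Irrational t) : ((t : ℝ) : AddCircle (1 : ℝ)) ∉ ratPts := by
  rintro ⟨r, hr⟩
  have hr : ((r : ℝ) : AddCircle (1 : ℝ)) = t := hr
  have h0 : (((r : ℝ) - t : ℝ) : AddCircle (1 : ℝ)) = 0 := by
    rw [AddCircle.coe_sub, hr, sub_self]
  obtain ⟨n, hn⟩ := (AddCircle.coe_eq_zero_iff (1 : ℝ)).1 h0
  have ht' : t = ((r - n : ℚ) : ℝ) := by
    push_cast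
    have : (n : ℝ) = (r : ℝ) - t := by simpa using hn
    linarith
  exact ht.ne_rat _ ht'

open scoped Classical in
/-- The conformal weight `λ : T² → {1, 2}`: `2` at points whose second coordinate is a rational
point of the circle, `1` otherwise (nowhere continuous). [folklore] -/
def lam (q : T) : ℝ := if q.2 ∈ ratPts then 2 else 1

/-- `1 ≤ λ ≤ 2`. [folklore] -/
theorem lam_mem (q : T) : 1 ≤ lam q ∧ lam q ≤ 2 := by
  unfold lam; split_ifs <;> norm_num

/-- `0 < λ`. [folklore] -/
theorem lam_pos (q : T) : 0 < lam q := by linarith [(lam_mem q).1]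

/-- `λ(proj y) = 2` if `y₁` is rational. [folklore] -/
theorem lam_proj_of_rat (y : P) (r : ℚ) (hy : y 1 = r) : lam (proj y) = 2 := by
  simp [lam, proj, hy, coe_rat_mem_ratPts]

/-- `λ(proj y) = 1` if `y₁` is irrational. [folklore] -/
theorem lam_proj_of_irrational (y : P) (hy : Irrational (y 1)) : lam (proj y) = 1 := by
  simp [lam, proj, coe_not_mem_ratPts hy]

/-- The bilinear form `g_q(u, v) = λ(q) u₀ v₀ + λ(q)⁻¹ u₁ v₁` on `ℝ²`. [folklore] -/
def form (q : T) : P →L[ℝ] P →L[ℝ] ℝ :=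
  lam q • (ContinuousLinearMap.proj 0).smulRight (ContinuousLinearMap.proj 0) +
    (lam q)⁻¹ • (ContinuousLinearMap.proj 1).smulRight (ContinuousLinearMap.proj 1)

/-- `g_q(u, v) = λ u₀ v₀ + λ⁻¹ u₁ v₁`. [folklore] -/
@[simp]
theorem form_apply (q : T) (u v : P) : form q u v = lam q * u 0 * v 0 + (lam q)⁻¹ * u 1 * v 1 := by
  simp [form, mul_comm, mul_assoc, mul_left_comm]

/-- `g_q(u, u) = λ u₀² + λ⁻¹ u₁²`. [folklore] -/
theorem form_self_eq (q : T) (u : P) : form q u u = lam q * u 0 ^ 2 + (lam q)⁻¹ * u 1 ^ 2 := by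
  rw [form_apply]; ring

/-- On the unit ball of `g_q` the sup norm is `< 2`. [folklore] -/
theorem norm_lt_two_of_form_self_lt_one (q : T) (u : P) (h : form q u u < 1) : ‖u‖ < 2 := by
  rw [form_self_eq] at h
  obtain ⟨h1, h2⟩ := lam_mem q; have hl := lam_pos q
  have hli : 0 < (lam q)⁻¹ := inv_pos.2 hl
  have ha : u 0 ^ 2 < 4 := by nlinarith [mul_nonneg hli.le (sq_nonneg (u 1)), sq_nonneg (u 0)]
  have hb : u 1 ^ 2 < 4 := by
    have h3 : (lam q)⁻¹ * u 1 ^ 2 < 1 := by nlinarith [mul_nonneg hl.le (sq_nonneg (u 0))]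
    have := mul_lt_mul_of_pos_left h3 hl
    rw [← mul_assoc, mul_inv_cancel₀ hl.ne', one_mul, mul_one] at this
    linarith
  have ha' : |u 0| < 2 := abs_lt.2 ⟨by nlinarith, by nlinarith⟩
  have hb' : |u 1| < 2 := abs_lt.2 ⟨by nlinarith, by nlinarith⟩
  rw [pi_norm_lt_iff (by norm_num : (0 : ℝ) < 2), Fin.forall_fin_two]
  exact ⟨by simpa [Real.norm_eq_abs] using ha', by simpa [Real.norm_eq_abs] using hb'⟩

/-- `g_q` is positive definite. [folklore] -/
theorem form_self_pos (q : T) {u : P} (hu : u ≠ 0) : 0 < form q u u := by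
  rw [form_self_eq]
  have hl := lam_pos q
  have hli : 0 < (lam q)⁻¹ := inv_pos.2 hl
  obtain h0 | h1 : u 0 ≠ 0 ∨ u 1 ≠ 0 := by
    simpa [Function.ne_iff, Fin.exists_fin_two] using hu
  · nlinarith [mul_nonneg hli.le (sq_nonneg (u 1)), mul_pos hl (pow_pos (abs_pos.2 h0) 2),
      sq_abs (u 0)]
  · nlinarith [mul_nonneg hl.le (sq_nonneg (u 0)), mul_pos hli (pow_pos (abs_pos.2 h1) 2),
      sq_abs (u 1)]

section MetricDef

attribute [local instance] chartedSpaceT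

set_option backward.isDefEq.respectTransparency false in
/-- The rough metric as a Mathlib `Bundle.RiemannianMetric` on the tangent spaces of `T²` (that
structure asks for no regularity in the base point). [folklore] -/
def metric : Bundle.RiemannianMetric (fun q : T ↦ TangentSpace 𝓘(ℝ, P) q) where
  inner q := form q
  symm q u v := by
    change form q u v = form q v u
    simp only [form_apply]; ring
  pos q u hu := form_self_pos q hu
  continuousAt q := by
    change ContinuousAt (fun u : P ↦ form q u u) 0
    have : (fun u : P ↦ form q u u) = fun u ↦ lam q * u 0 * u 0 + (lam q)⁻¹ * u 1 * u 1 := by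
      funext u; exact form_apply q u u
    rw [this]
    fun_prop
  isVonNBounded q := by
    change Bornology.IsVonNBounded ℝ {u : P | form q u u < 1}
    refine (NormedSpace.isVonNBounded_ball ℝ P 2).subset fun u hu ↦ ?_
    rw [Metric.mem_ball, dist_zero_right]
    exact norm_lt_two_of_form_self_lt_one q u hu

/-- The rough metric as a `RiemannianBundle` structure (a reducible `def`, used as a local instance
and supplied explicitly to the fact under refutation). [folklore] -/
@[reducible]
def bundle : Bundle.RiemannianBundle (fun q : T ↦ TangentSpace 𝓘(ℝ, P) q) := ⟨metric⟩

/-- `√λ(q)` as a unit. [folklore] -/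
def sqrtLamUnit (q : T) : ℝˣ := Units.mk0 (Real.sqrt (lam q)) (Real.sqrt_ne_zero'.2 (lam_pos q))

/-- The column weights `(√λ)⁻¹, √λ` (product `1`). [folklore] -/
def weights (q : T) : Fin 2 → ℝˣ := ![(sqrtLamUnit q)⁻¹, sqrtLamUnit q]

/-- `∏ weights = 1`. [folklore] -/
theorem prod_weights (q : T) : ∏ i, weights q i = 1 := by
  simp [weights, Fin.prod_univ_two]

/-- The standard basis `e₀, e₁` of `T_q T² = ℝ²`. [folklore] -/
def stdBasisT (q : T) : Basis (Fin 2) ℝ (TangentSpace 𝓘(ℝ, P) q) := Pi.basisFun ℝ (Fin 2)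

/-- `stdBasisT q i = eᵢ`. [folklore] -/
@[simp]
theorem stdBasisT_apply (q : T) (i : Fin 2) : stdBasisT q i = (Pi.single i 1 : P) :=
  Pi.basisFun_apply ℝ (Fin 2) i

/-- The standard orientation on every tangent space of `T²`. [folklore] -/
def orient (q : T) : Orientation ℝ (TangentSpace 𝓘(ℝ, P) q) (Fin 2) := (stdBasisT q).orientation

/-- The basis `(√λ)⁻¹ e₀, √λ e₁`. [folklore] -/
def scaledBasis (q : T) : Basis (Fin 2) ℝ (TangentSpace 𝓘(ℝ, P) q) :=
  (stdBasisT q).unitsSMul (weights q)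

/-- `scaledBasis q 0 = (√λ)⁻¹ e₀`. [folklore] -/
theorem scaledBasis_zero (q : T) :
    scaledBasis q 0 = ((Real.sqrt (lam q))⁻¹ : ℝ) • (Pi.single 0 1 : P) := by
  rw [scaledBasis, Basis.unitsSMul_apply, Units.smul_def, stdBasisT_apply]
  simp only [weights, Matrix.cons_val_zero, Units.val_inv_eq_inv_val, sqrtLamUnit, Units.val_mk0]
  rfl

/-- `scaledBasis q 1 = √λ e₁`. [folklore] -/
theorem scaledBasis_one (q : T) :
    scaledBasis q 1 = (Real.sqrt (lam q) : ℝ) • (Pi.single 1 1 : P) := by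
  rw [scaledBasis, Basis.unitsSMul_apply, Units.smul_def, stdBasisT_apply]
  simp only [weights, Matrix.cons_val_one, Matrix.cons_val_zero, sqrtLamUnit, Units.val_mk0]
  rfl

end MetricDef

section WithMetric

open Bundle

attribute [local instance] chartedSpaceT bundle StepMetric.factFinrank

/-- The inner product of the rough metric on `T_q T²` (definitional). [folklore] -/
theorem inner_eq (q : T) (u v : TangentSpace 𝓘(ℝ, P) q) :
    ⟪u, v⟫_ℝ = lam q * u 0 * v 0 + (lam q)⁻¹ * u 1 * v 1 :=
  form_apply q u v

/-- `(√λ)⁻¹ e₀, √λ e₁` is `g_q`-orthonormal. [folklore] -/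
theorem scaledBasis_orthonormal (q : T) : Orthonormal ℝ (scaledBasis q) := by
  have hl : 0 < lam q := lam_pos q
  have hs : Real.sqrt (lam q) ^ 2 = lam q := Real.sq_sqrt hl.le
  rw [orthonormal_iff_ite]
  intro i j
  fin_cases i <;> fin_cases j <;> rw [inner_eq] <;>
    simp [scaledBasis_zero, scaledBasis_one] <;> field_simp <;> nlinarith [hs, hl]

/-- The `g_q`-orthonormal basis `(√λ)⁻¹ e₀, √λ e₁`. [folklore] -/
def onBasis (q : T) : OrthonormalBasis (Fin 2) ℝ (TangentSpace 𝓘(ℝ, P) q) :=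
  (scaledBasis q).toOrthonormalBasis (scaledBasis_orthonormal q)

/-- The underlying basis of `onBasis q` is `scaledBasis q`. [folklore] -/
theorem toBasis_onBasis (q : T) : (onBasis q).toBasis = scaledBasis q :=
  Basis.toBasis_toOrthonormalBasis _ _

/-- `onBasis` is positively oriented. [folklore] -/
theorem orientation_onBasis (q : T) : (onBasis q).toBasis.orientation = orient q := by
  rw [toBasis_onBasis]
  have h := Basis.orientation_unitsSMul (stdBasisT q) (weights q)
  rw [prod_weights, inv_one, one_smul] at h
  exact h

/-- **The volume form of the rough metric is the standard determinant** (`det g = 1`).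
[folklore] -/
theorem volumeForm_eq (q : T) (v : Fin 2 → TangentSpace 𝓘(ℝ, P) q) :
    (orient q).volumeForm v = (stdBasisT q).det v := by
  rw [Orientation.volumeForm_robust _ (onBasis q) (orientation_onBasis q), toBasis_onBasis]
  have h := Basis.det_unitsSMul (stdBasisT q) (weights q)
  rw [prod_weights, inv_one, Units.val_one, one_smul] at h
  exact congrArg (fun D ↦ D v) h

/-- The Riemannian volume form of the rough metric evaluates as the standard determinant.
[folklore] -/
theorem riemannianVolumeForm_apply_eq (q : T) (v : Fin 2 → TangentSpace 𝓘(ℝ, P) q) :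
    riemannianVolumeForm orient q v = (stdBasisT q).det v := by
  simp only [riemannianVolumeForm_apply, Orientation.volumeFormL_apply, volumeForm_eq]

/-- The Riemannian volume form of the rough metric is constant (`= dx₀ ∧ dx₁`). [folklore] -/
theorem riemannianVolumeForm_eq (q : T) :
    riemannianVolumeForm orient q = riemannianVolumeForm orient (proj 0) := by
  ext v
  rw [riemannianVolumeForm_apply_eq]
  exact (riemannianVolumeForm_apply_eq (proj 0) v).symm

/-- The (constant) volume form of the rough metric is smooth: the hypothesis `ho` of the fact
holds for `orient`. [folklore] -/
theorem isSmoothForm_riemannianVolumeForm : IsSmoothForm (riemannianVolumeForm orient) := by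
  intro x
  rw [inChart_eq]
  have : (fun y : P ↦ (riemannianVolumeForm orient (proj y) : P [⋀^Fin 2]→L[ℝ] ℝ)) =
      fun _ ↦ riemannianVolumeForm orient (proj 0) := funext fun y ↦ riemannianVolumeForm_eq _
  rw [this]
  exact contDiffWithinAt_const

/-! ### The smooth top-degree form `α = F(x₁) · vol`, `F' = sin³(2π ·)` -/

/-- `F(t) = -cos(2πt)/(2π) + cos³(2πt)/(6π)`, a `1`-periodic primitive of `sin³(2πt)`.
[folklore] -/
def F (t : ℝ) : ℝ := -Real.cos (2 * π * t) / (2 * π) + Real.cos (2 * π * t) ^ 3 / (6 * π)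

/-- `S(t) = sin³(2πt)` (`= F'(t)`). [folklore] -/
def S (t : ℝ) : ℝ := Real.sin (2 * π * t) ^ 3

/-- `F' = S`. [folklore] -/
theorem hasDerivAt_F (t : ℝ) : HasDerivAt F (S t) t := by
  have h1 : HasDerivAt (fun t : ℝ ↦ 2 * π * t) (2 * π) t := by
    simpa using (hasDerivAt_id t).const_mul (2 * π)
  have hc : HasDerivAt (fun t : ℝ ↦ Real.cos (2 * π * t)) (-Real.sin (2 * π * t) * (2 * π)) t :=
    (Real.hasDerivAt_cos (2 * π * t)).comp t h1
  have hF := (hc.neg.div_const (2 * π)).add ((hc.pow 3).div_const (6 * π))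
  have key : Real.sin (2 * π * t) ^ 3 =
      Real.sin (2 * π * t) - Real.cos (2 * π * t) ^ 2 * Real.sin (2 * π * t) := by
    linear_combination Real.sin (2 * π * t) * Real.sin_sq_add_cos_sq (2 * π * t)
  refine hF.congr_deriv ?_
  rw [S, key]
  norm_num
  field_simp
  ring

/-- `F` is `C^∞`. [folklore] -/
theorem contDiff_F : ContDiff ℝ ∞ F := by
  unfold F; fun_prop

/-- `S` is continuous. [folklore] -/
theorem continuous_S : Continuous S := by
  unfold S; fun_prop

/-- `F` is `1`-periodic. [folklore] -/
theorem periodic_F : Function.Periodic F 1 := fun t ↦ by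
  simp only [F, mul_add, mul_one, Real.cos_add_two_pi]

/-- `S` is `1`-periodic. [folklore] -/
theorem periodic_S : Function.Periodic S 1 := fun t ↦ by
  simp only [S, mul_add, mul_one, Real.sin_add_two_pi]

/-- `F` descended to the circle `ℝ/ℤ`. [folklore] -/
def Fc : AddCircle (1 : ℝ) → ℝ := periodic_F.lift

/-- `S` descended to the circle `ℝ/ℤ`. [folklore] -/
def Sc : AddCircle (1 : ℝ) → ℝ := periodic_S.lift

/-- `Fc ↑t = F t`. [folklore] -/
theorem Fc_coe (t : ℝ) : Fc (t : AddCircle (1 : ℝ)) = F t := periodic_F.lift_coe t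

/-- `Sc ↑t = S t`. [folklore] -/
theorem Sc_coe (t : ℝ) : Sc (t : AddCircle (1 : ℝ)) = S t := periodic_S.lift_coe t

/-- The coefficient `f(q) = F(x₁)` on `T²`. [folklore] -/
def f (q : T) : ℝ := Fc q.2

/-- `f (proj y) = F (y 1)`. [folklore] -/
theorem f_proj (y : P) : f (proj y) = F (y 1) := Fc_coe _

/-- `S` at the canonical lift of `q` is `Sc q.2`. [folklore] -/
theorem S_lift (q : T) : S ((lift q) 1) = Sc q.2 := by
  rw [← Sc_coe]
  exact congrArg Sc (congrArg Prod.snd (proj_lift q))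

/-- `y ↦ F (y 1)` has derivative `S (y 1) • pr₁`. [folklore] -/
theorem hasFDerivAt_F_apply_one (y : P) :
    HasFDerivAt (fun y : P ↦ F (y 1)) (S (y 1) • (ContinuousLinearMap.proj 1 : P →L[ℝ] ℝ)) y :=
  HasDerivAt.comp_hasFDerivAt (h₂ := F) y (hasDerivAt_F (y 1))
    (ContinuousLinearMap.proj (R := ℝ) (φ := fun _ : Fin 2 ↦ ℝ) 1).hasFDerivAt

/-- The constant `1`-form `dx₀` on `ℝ²`. [folklore] -/
def dx₀ : P [⋀^Fin 1]→L[ℝ] ℝ := ofSubsingleton ℝ P ℝ (0 : Fin 1) (ContinuousLinearMap.proj 0)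

/-- `dx₀ [w] = w 0`. [folklore] -/
@[simp]
theorem dx₀_apply (u : Fin 1 → P) : dx₀ u = u 0 0 := by
  simp [dx₀]

/-- The smooth top-degree form `α = f · vol` on `T²`. [folklore] -/
def alpha : MForm 𝓘(ℝ, P) T ℝ 2 := fun q ↦ f q • riemannianVolumeForm orient q

/-- `α (proj y) = F (y 1) · (dx₀ ∧ dx₁)`. [folklore] -/
theorem alpha_proj (y : P) :
    @Eq (P [⋀^Fin 2]→L[ℝ] ℝ) (alpha (proj y)) (F (y 1) • riemannianVolumeForm orient (proj 0)) := by
  change f (proj y) • riemannianVolumeForm orient (proj y) = _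
  rw [f_proj, riemannianVolumeForm_eq]
  rfl

/-- `α` is smooth. [folklore] -/
theorem isSmoothForm_alpha : IsSmoothForm alpha := by
  intro x
  rw [inChart_eq]
  have hfun : (fun y ↦ (alpha (proj y) : P [⋀^Fin 2]→L[ℝ] ℝ)) =
      fun y ↦ F (y 1) • riemannianVolumeForm orient (proj 0) := funext alpha_proj
  rw [hfun]
  exact ((contDiff_F.comp (contDiff_apply ℝ ℝ (1 : Fin 2))).smul contDiff_const).contDiffWithinAt

/-- `⋆α = f` (a `0`-form): `⋆(f · vol) = f · ⋆vol = f` pointwise (`hodgeStar_volumeFormL_holds`).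
[folklore] -/
theorem hodgeStar_alpha (h : 1 + 1 + 0 = 2) (q : T) :
    MForm.hodgeStar orient h alpha q = constOfIsEmpty ℝ (TangentSpace 𝓘(ℝ, P) q) (Fin 0) (f q) := by
  rw [MForm.hodgeStar_apply]
  change hodgeStar (orient q) h ((f q) • (orient q).volumeFormL) = _
  rw [map_smul, hodgeStar_volumeFormL_holds (orient q) h]
  ext v
  simp

/-- `d⋆α = S(x₁) dx₁` at every point: the flat derivative of the periodic pull-back
`y ↦ F (y 1)` at the canonical lift (`mextDeriv_apply_eq`, `extDeriv_constOfIsEmpty`). [folklore] -/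
theorem mextDeriv_hodgeStar_alpha (h : 1 + 1 + 0 = 2) (q : T) :
    mextDeriv (MForm.hodgeStar orient h alpha) q =
      ofSubsingleton ℝ (TangentSpace 𝓘(ℝ, P) q) ℝ (0 : Fin 1)
        (Sc q.2 • (ContinuousLinearMap.proj 1 : P →L[ℝ] ℝ)) := by
  have hfun : (MForm.hodgeStar orient h alpha : MForm 𝓘(ℝ, P) T ℝ 0) =
      fun q ↦ constOfIsEmpty ℝ P (Fin 0) (f q) := funext (hodgeStar_alpha h)
  rw [hfun, mextDeriv_apply_eq]
  have hfun' : (fun y : P ↦ (constOfIsEmpty ℝ P (Fin 0) (f (proj y)) : P [⋀^Fin 0]→L[ℝ] ℝ)) =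
      fun y ↦ constOfIsEmpty ℝ P (Fin 0) (F (y 1)) := funext fun y ↦ by rw [f_proj]
  rw [hfun', extDeriv_constOfIsEmpty, (hasFDerivAt_F_apply_one (lift q)).fderiv, S_lift]
  rfl

/-- The `1`-form `c · dx₁` is `⟪c λ e₁, ·⟫` for the rough metric. [folklore] -/
theorem smul_proj_one_eq_innerSL (q : T) (c : ℝ) :
    (c • (ContinuousLinearMap.proj 1 : P →L[ℝ] ℝ) : TangentSpace 𝓘(ℝ, P) q →L[ℝ] ℝ) =
      innerSL ℝ (E := TangentSpace 𝓘(ℝ, P) q) ((c * lam q : ℝ) • (Pi.single 1 1 : P)) := by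
  ext w
  change c * w 1 = @inner ℝ (TangentSpace 𝓘(ℝ, P) q) _ ((c * lam q : ℝ) • (Pi.single 1 1 : P)) w
  rw [inner_eq]
  have h3 : (lam q)⁻¹ * (c * lam q) = c := by field_simp [(lam_pos q).ne']
  simp only [Pi.smul_apply, Pi.single_apply, smul_eq_mul]
  simp [h3]

/-- **`⋆(c dx₁) = -c λ dx₀`** for the rough metric, evaluated on a vector `w`:
`⋆⟪v, ·⟫ = ω(v, ·)` (`hodgeStar_apply_eq_areaForm_holds`) and `ω = vol = det` (`volumeForm_eq`).
[folklore] -/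
theorem hodgeStar_smul_dx₁_apply (h : 1 + 1 = 2) (q : T) (c : ℝ) (w : P) :
    hodgeStar (orient q) h
        (ofSubsingleton ℝ (TangentSpace 𝓘(ℝ, P) q) ℝ (0 : Fin 1)
          (c • (ContinuousLinearMap.proj 1 : P →L[ℝ] ℝ))) ![w] = -(c * lam q * w 0) := by
  rw [smul_proj_one_eq_innerSL q c, hodgeStar_apply_eq_areaForm_holds (orient q),
    Orientation.areaForm_to_volumeForm, volumeForm_eq]
  change (Pi.basisFun ℝ (Fin 2)).det ![(c * lam q) • (Pi.single 1 1 : P), w] = -(c * lam q * w 0)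
  rw [Pi.basisFun_det, show Matrix.detRowAlternating ![(c * lam q) • (Pi.single 1 1 : P), w] =
      Matrix.det (Matrix.of ![(c * lam q) • (Pi.single 1 1 : P), w]) from rfl, Matrix.det_fin_two]
  simp [Matrix.of_apply]

/-- **`δα = λ S(x₁) dx₀`**: the codifferential of `α` evaluated on `w` is `λ(q) S(x₁) w₀`
(`δ = (-1)^{n·k+1} ⋆d⋆` with `n = 2`, `k = 1`). [folklore] -/
theorem mcoderiv_alpha_apply (h : 1 + 1 + 0 = 2) (q : T) (w : P) :
    mcoderiv orient h alpha q ![w] = lam q * Sc q.2 * w 0 := by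
  simp only [mcoderiv, Pi.smul_apply, ContinuousAlternatingMap.smul_apply, MForm.hodgeStar_apply]
  rw [mextDeriv_hodgeStar_alpha h q, hodgeStar_smul_dx₁_apply, smul_eq_mul]
  ring

/-- The coefficient of the periodic pull-back of `δα`: `c(y) = λ(proj y) · S(y₁)`. [folklore] -/
def coef (y : P) : ℝ := lam (proj y) * S (y 1)

/-- The periodic pull-back of `δα` is `y ↦ c(y) dx₀`. [folklore] -/
theorem mcoderiv_alpha_proj (h : 1 + 1 + 0 = 2) (y : P) :
    (coef y • dx₀ : P [⋀^Fin 1]→L[ℝ] ℝ) = mcoderiv orient h alpha (proj y) := by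
  ext u
  rw [ContinuousAlternatingMap.smul_apply, dx₀_apply]
  have hu : (![u 0] : Fin 1 → TangentSpace 𝓘(ℝ, P) (proj y)) = u := by
    funext i
    fin_cases i
    rfl
  have key := mcoderiv_alpha_apply h (proj y) (u 0)
  rw [show (proj y).2 = ((y 1 : ℝ) : AddCircle (1 : ℝ)) from rfl, Sc_coe] at key
  calc coef y • u 0 0 = lam (proj y) * S (y 1) * u 0 0 := by rw [coef, smul_eq_mul]
    _ = mcoderiv orient h alpha (proj y) ![u 0] := key.symm
    _ = mcoderiv orient h alpha (proj y) u := by rw [hu]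

/-! ### The junk analysis: `d(δα) = 0` everywhere -/

/-- The weight along the fibre `t ↦ λ(proj (…, t))`: `2` on rationals, `1` on irrationals, hence
continuous nowhere. [folklore] -/
theorem not_continuousAt_lam_line (y : P) :
    ¬ ContinuousAt (fun t : ℝ ↦ lam (proj (Function.update y 1 t))) (y 1) := by
  intro hL
  obtain ⟨δ, hδ, hball⟩ := Metric.continuousAt_iff.1 hL 2⁻¹ (by norm_num)
  obtain ⟨r, hr1, hr2⟩ := exists_rat_btwn (show y 1 < y 1 + δ by linarith)
  obtain ⟨i, hi, hi1, hi2⟩ := exists_irrational_btwn (show y 1 < y 1 + δ by linarith)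
  have hr := hball (x := r) (by rw [Real.dist_eq, abs_lt]; constructor <;> linarith)
  have hi' := hball (x := i) (by rw [Real.dist_eq, abs_lt]; constructor <;> linarith)
  rw [lam_proj_of_rat (Function.update y 1 (r : ℝ)) r (by simp), Real.dist_eq] at hr
  rw [lam_proj_of_irrational (Function.update y 1 i) (by simpa using hi), Real.dist_eq] at hi'
  rw [abs_lt] at hr hi'
  linarith [hr.1, hr.2, hi'.1, hi'.2]

/-- Where `S(y₁) ≠ 0` the coefficient `c = λ S` is not continuous (`S` is, `λ` is not).
[folklore] -/
theorem not_continuousAt_coef {y : P} (hy : S (y 1) ≠ 0) : ¬ ContinuousAt coef y := by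
  intro hc
  have hu : Continuous fun t : ℝ ↦ Function.update y 1 t := by fun_prop
  have h1 : ContinuousAt (fun t : ℝ ↦ coef (Function.update y 1 t)) (y 1) :=
    hc.comp_of_eq hu.continuousAt (by simp)
  have h2 : ContinuousAt (fun t : ℝ ↦ coef (Function.update y 1 t) / S t) (y 1) :=
    h1.div (continuous_S.continuousAt) hy
  have h3 : (fun t : ℝ ↦ coef (Function.update y 1 t) / S t) =ᶠ[𝓝 (y 1)]
      fun t ↦ lam (proj (Function.update y 1 t)) := by
    have hne : ∀ᶠ t in 𝓝 (y 1), S t ≠ 0 :=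
      continuous_S.continuousAt.eventually_ne hy
    filter_upwards [hne] with t ht
    simp only [coef, Function.update_self]
    field_simp
  exact not_continuousAt_lam_line y (h2.congr h3)

/-- At a zero of `sin(2π ·)` the coefficient `c` vanishes to second order:
`|c(y)| ≤ 2 (2π)² ‖y - y₀‖²`. [folklore] -/
theorem abs_coef_le {y₀ : P} (h0 : Real.sin (2 * π * y₀ 1) = 0) (y : P) :
    |coef y| ≤ 2 * (2 * π) ^ 2 * ‖y - y₀‖ ^ 2 := by
  obtain ⟨n, hn⟩ := Real.sin_eq_zero_iff.1 h0
  have hsin : |Real.sin (2 * π * y 1)| ≤ 2 * π * ‖y - y₀‖ := by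
    have : 2 * π * y 1 = 2 * π * (y 1 - y₀ 1) + n * π := by rw [hn]; ring
    rw [this, Real.sin_add_int_mul_pi, abs_mul, abs_zpow, abs_neg, abs_one, one_zpow, one_mul]
    refine le_trans Real.abs_sin_le_abs ?_
    rw [abs_mul, abs_of_pos (by positivity : (0 : ℝ) < 2 * π)]
    gcongr
    simpa [Real.norm_eq_abs] using norm_le_pi_norm (y - y₀) 1
  have hs1 : |Real.sin (2 * π * y 1)| ≤ 1 := Real.abs_sin_le_one _
  have hl : |lam (proj y)| ≤ 2 := by
    rw [abs_of_pos (lam_pos _)]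
    exact (lam_mem _).2
  have hnn : 0 ≤ 2 * π * ‖y - y₀‖ := by positivity
  calc |coef y| = |lam (proj y)| * |Real.sin (2 * π * y 1)| ^ 3 := by
        rw [coef, S, abs_mul, abs_pow]
    _ ≤ 2 * ((2 * π * ‖y - y₀‖) ^ 2 * 1) := by
        gcongr
        · calc |Real.sin (2 * π * y 1)| ^ 3
              = |Real.sin (2 * π * y 1)| ^ 2 * |Real.sin (2 * π * y 1)| := by ring
            _ ≤ (2 * π * ‖y - y₀‖) ^ 2 * 1 := by
                gcongr
    _ = 2 * (2 * π) ^ 2 * ‖y - y₀‖ ^ 2 := by ring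

/-- At a zero of `sin(2π ·)` the pull-back `y ↦ c(y) dx₀` is differentiable with derivative `0`
(it vanishes to second order). [folklore] -/
theorem hasFDerivAt_coef_smul {y₀ : P} (h0 : Real.sin (2 * π * y₀ 1) = 0) :
    HasFDerivAt (fun y : P ↦ coef y • dx₀) (0 : P →L[ℝ] P [⋀^Fin 1]→L[ℝ] ℝ) y₀ := by
  have hc0 : coef y₀ = 0 := by simp [coef, S, h0]
  rw [hasFDerivAt_iff_isLittleO_nhds_zero]
  simp only [hc0, zero_smul, sub_zero, zero_apply]
  have hO : (fun h : P ↦ coef (y₀ + h) • dx₀) =O[𝓝 0] fun h : P ↦ ‖h - 0‖ ^ 2 := by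
    refine Asymptotics.IsBigO.of_bound (2 * (2 * π) ^ 2 * ‖dx₀‖) (Filter.Eventually.of_forall fun h ↦ ?_)
    rw [norm_smul, Real.norm_eq_abs, sub_zero, Real.norm_of_nonneg (by positivity)]
    have := abs_coef_le h0 (y₀ + h)
    rw [add_sub_cancel_left] at this
    nlinarith [norm_nonneg dx₀, norm_nonneg h]
  have hlo : (fun h : P ↦ ‖h - 0‖ ^ 2) =o[𝓝 0] fun h : P ↦ h :=
    (Asymptotics.isLittleO_pow_sub_sub (0 : P) one_lt_two).congr_right fun h ↦ sub_zero h
  exact hO.trans_isLittleO hlo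

/-- **`fderiv (c dx₀) = 0` everywhere**: a junk zero where `S(y₁) ≠ 0` (no continuity), a
genuine zero where `sin(2π y₁) = 0` (second-order vanishing). [folklore] -/
theorem fderiv_coef_smul (y : P) : fderiv ℝ (fun y : P ↦ coef y • dx₀) y = 0 := by
  by_cases hS : Real.sin (2 * π * y 1) = 0
  · exact (hasFDerivAt_coef_smul hS).fderiv
  · have hy : S (y 1) ≠ 0 := pow_ne_zero 3 hS
    apply fderiv_zero_of_not_differentiableAt
    intro hd
    apply not_continuousAt_coef hy
    have h1 : ContinuousAt (fun y : P ↦ (coef y • dx₀) ![(Pi.single 0 1 : P)]) y :=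
      ((ContinuousAlternatingMap.apply ℝ P ℝ ![(Pi.single 0 1 : P)]).continuous.continuousAt).comp
        hd.continuousAt
    simpa using h1

/-- `d(c dx₀) = 0` at every point of `ℝ²`. [folklore] -/
theorem extDeriv_coef_smul (y : P) : extDeriv (fun y : P ↦ coef y • dx₀) y = 0 := by
  rw [extDeriv, fderiv_coef_smul]
  exact map_zero (alternatizeUncurryFinCLM ℝ P ℝ)

/-! ### Assembly -/

/-- **`α` is harmonic for the rough metric**: `Δα = d(δα)` (top degree) and
`d(δα)(q) = d(c dx₀)(lift q) = 0`. [folklore] -/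
theorem isHarmonicForm_alpha (h : 1 + 1 + 0 = 2) : IsHarmonicForm orient h alpha := by
  refine ⟨isSmoothForm_alpha, ?_⟩
  simp only [hodgeLaplacian]
  funext q
  rw [mextDeriv_apply_eq, Pi.zero_apply]
  have hfun : (fun y : P ↦ (mcoderiv orient h alpha (proj y) : P [⋀^Fin 1]→L[ℝ] ℝ)) =
      fun y ↦ coef y • dx₀ := (funext (mcoderiv_alpha_proj h)).symm
  rw [hfun, extDeriv_coef_smul]
  rfl

/-- **`δα ≠ 0`**: at `proj (0, 1/4)` the codifferential takes the value `λ · S(1/4) = λ ≠ 0` on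
`e₀`. [folklore] -/
theorem mcoderiv_alpha_ne_zero (h : 1 + 1 + 0 = 2) : mcoderiv orient h alpha ≠ 0 := by
  intro H
  have key := mcoderiv_alpha_apply h (proj ![0, 4⁻¹]) (Pi.single 0 1)
  rw [H, show (proj ![0, 4⁻¹]).2 = (((4⁻¹ : ℝ)) : AddCircle (1 : ℝ)) from rfl, Sc_coe] at key
  have hS : S 4⁻¹ = 1 := by
    simp only [S]
    rw [show 2 * π * 4⁻¹ = π / 2 by ring, Real.sin_pi_div_two]
    norm_num
  rw [hS] at key
  have hl := lam_pos (proj ![0, 4⁻¹])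
  simp at key
  linarith

/-- **The named fact `isHarmonicForm_iff_mextDeriv_eq_zero_and_mcoderiv_eq_zero` is false for
the rough metric on the torus** (`n = 2`, `k = 1`, `m = 0`): `α = F(x₁) vol` is smooth and
harmonic (`Δα = dδα = 0`), yet `δα ≠ 0`. [folklore] -/
theorem not_isHarmonicForm_iff_torus :
    ¬ @isHarmonicForm_iff_mextDeriv_eq_zero_and_mcoderiv_eq_zero P _ _ 2 StepMetric.factFinrank P _ 𝓘(ℝ, P)
        T _ chartedSpaceT _ bundle 1 0 orient := by
  intro H
  have h2 : (1 + 1 + 0 : ℕ) = 2 := by norm_num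
  have := (H isSmoothForm_riemannianVolumeForm h2 isSmoothForm_alpha).1 (isHarmonicForm_alpha h2)
  exact mcoderiv_alpha_ne_zero h2 this.2

end WithMetric

end TorusRough

section UniversalClosure

attribute [local instance] TorusRough.chartedSpaceT TorusRough.bundle StepMetric.factFinrank

/-- **`isHarmonicForm_iff_mextDeriv_eq_zero_and_mcoderiv_eq_zero` cannot be discharged as
stated**: its universal closure over charted spaces modelled on `ℝ²` with Riemannian bundle metrics
of no regularity is false already for `k + 1 = 2`, `m = 0` (witness: the compact torus `T²` with
the rough metric `TorusRough.bundle` and the standard orientation,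
`TorusRough.not_isHarmonicForm_iff_torus`). The intended statement is Warner (1983), Prop. 6.3
(smooth metric). [folklore] -/
theorem not_isHarmonicForm_iff_mextDeriv_eq_zero_and_mcoderiv_eq_zero :
    ¬ ∀ (M : Type) [TopologicalSpace M] [ChartedSpace TorusRough.P M]
        [Bundle.RiemannianBundle (fun x : M ↦ TangentSpace 𝓘(ℝ, TorusRough.P) x)]
        (o : (x : M) → Orientation ℝ (TangentSpace 𝓘(ℝ, TorusRough.P) x) (Fin 2)),
        isHarmonicForm_iff_mextDeriv_eq_zero_and_mcoderiv_eq_zero (k := 1) (m := 0) o :=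
  fun H ↦ TorusRough.not_isHarmonicForm_iff_torus (H TorusRough.T TorusRough.orient)

end UniversalClosure

end Literature.Geometry.Kaehler
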